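import Summits.Langlands.Langlands.Theses.EmbeddingNecklace

/-!
# Birth skeleton (BC3) for crux stmt-Langlands-18132
`Summit.Langlands.Langlands.Theses.EmbeddingNecklace.DeRhamLiftingIrred` — line `birth`

THE CRUX (route `EmbeddingNecklace`, rank 4; `ledger workitem get stmt-Langlands-18132`): for `F` totally
real, `p ≥ 5` UNRAMIFIED in `F` (`p ∤ disc F`, no residue-degree hypothesis), `ρ : Γ_F → GL₂(ℚ̄_p)`
irreducible, unramified a.e., totally odd, de Rham at every `v ∣ p` for Fontaine's pinned datum
`fontainePstAdicCompletion v p hv` with two DISTINCT `τ`-labelled Hodge–Tate weights for every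
`ℚ_p`-embedding `τ : F_v → ℚ̄_p`, residually absolutely irreducible at EVERY `v ∣ p` (trace rendering:
no finite-order `χ₁, χ₂` of `Γ_{F_v}` with `‖tr ρ|Γ_{F_v} − χ₁ − χ₂‖ < 1`), `ρ̄|Γ_{F(ζ_p)}` absolutely
irreducible (same rendering) and residually modular (trace-congruent to a `ρ₀` attached a.e. to a regular
L-algebraic cuspidal `π₀`) ⟹ `ρ` is attached a.e. (`SatakeFrobCompatibleAE ι π.1 ρ`) to a regular
L-algebraic cuspidal `π` of `GL₂(𝔸_F)`.  Grounded OPEN PROBLEM as typed (all-weight Fontaine–Mazur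
lifting at `F_v = ℚ_{p^f}`, `f` arbitrary, supersingular-residual sector).

THE LINE `birth` = the route's own foreseen two-layer plan for this node (route header, TWO-LAYER PLAN:
"DeRhamLiftingIrred ⇐ IrredParallel → IrredNonParallel → DeRhamLiftingIrred"), cut along the seam the
route's mechanism itself draws — the shape of the labelled Hodge–Tate type above `p`:

* `stub_irredParallel` — the crux restricted to `ρ` whose labelled Hodge–Tate type is PARALLEL at every
  `v ∣ p`: `HT_{τ₁}(ρ|Γ_{F_v}) = HT_{τ₂}(ρ|Γ_{F_v})` for all `ℚ_p`-embeddings `τ₁, τ₂ : F_v → ℚ̄_p`.  Here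
  the Hilbert / `U(1,1)^f` variety realising `⊗_τ ρ^τ` has a de Rham filtration whose Fontaine
  operator IS defined by the filtration (no `2^f`-jump obstruction), and classicality of the
  pro-modular eigensystem is in print in the inert BHHMS-generic case (Jiang2026 Thm 1.1.1/1.1.4,
  parallel weights; Rem 1.1.5: unramified `p` and general regular parallel weights "should suffice");
  `f_v = 1` at all `v ∣ p` is Kisin2009 (2.2.18) / HuTan2015 Thm 6.3 (every `ρ` is parallel at a place
  with one embedding), `f_v ≤ 2` generic is Matsumoto2025 Thm 1.2.  Open remainder inside the stub:
  several `v ∣ p` with `f_v ≥ 3`, non-generic (extreme-digit) irreducible `ρ̄|Γ_{F_v}`, arbitrary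
  ramification away from `p` (Jiang's formally-smooth hypothesis (4)), `p = 5`.  Size XL (open).
* `stub_irredNonParallel` — the crux restricted to `ρ` whose labelled Hodge–Tate type is NOT parallel at
  SOME `v ∣ p`: two `ℚ_p`-embeddings `τ₁, τ₂ : F_v → ℚ̄_p` with `HT_{τ₁} ≠ HT_{τ₂}` (which forces
  `[F_v : ℚ_p] ≥ 2`, i.e. `f_v ≥ 2` as `p` is unramified).  This is the necklace's own regime (route
  header, WHY THIS LINE): every variety with a geometric direction for all `τ` meets the `2^f`-jump wall
  in non-parallel weight (Matsumoto2025 Rem 1.15 / Conj 1.13, Jiang2026 Rem 1.1.3), and the route's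
  informal mechanism items PartialAlgebraization (stmt-Langlands-18136, QiuSu2025 Conj 2.1.2 'if'),
  NecklaceTransport (18137), NecklaceClosure (18138) + supports BigRTEigenvector (18139),
  LocallyAlgebraicClassical (18140) are exactly the plan for it; in print only for `f_v = 2` at every
  `v ∣ p` with Serre-weight genericity (Matsumoto2025 Thm 1.2 (6)).  LOAD-BEARING / hardest.  Size XL.

Composition `DeRhamLiftingIrred_of : stub₁-sig → stub₂-sig → DeRhamLiftingIrred` (kernel-checked, no
`sorry`): excluded middle on "parallel at every `v ∣ p`"; `push Not` hands the non-parallel witness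
`(v, τ₁, τ₂)` to the second stub.  The join is deliberately trivial (a sector seam, BC2 "trivial_seam"):
the mathematics is in the two halves, which are DIFFERENT theorems with different engines (tensor-
induction varieties vs. the necklace of `|Ψ| ≤ 2` curves/surfaces), neither implying the crux or the
summit cheaply (BC3 probes below).

Typing notes.  (i) The stubs repeat the crux's binders VERBATIM except that the `p`-adic Hodge clause
`let D := fontainePstAdicCompletion v p hv; D.IsDeRhamFramed (ρ.toLocal v) ∧ (letI := D.algebra; ∀ τ,
let M := …; M.Nodup ∧ Multiset.card M = 2)` is written `let`-free (the registry truncates a stub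
signature at its first `:=`): `τ` ranges over `@AlgHom ℚ_[p] (v.adicCompletion F) (PadicAlgCl p) _ _ _
(fontainePstAdicCompletion v p hv).algebra _` and enters `labelledHodgeTateWeightsAt` through the
coercion `(τ : v.adicCompletion F →+* PadicAlgCl p)`; the two renderings agree by `Iff.rfl` (checked in
the registrar's scratch `bc/T1_render.lean`, rc 0), so the composition passes the crux's hypothesis
`hdR` to the stubs by `exact`.  (ii) "Parallel at `v`" is stated pairwise (`∀ τ₁ τ₂, HT_{τ₁} = HT_{τ₂}`)
over the SAME embedding type the crux quantifies over, so no continuity / `ℚ_p`-linearity side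
condition is smuggled in and the negation is literally the second stub's hypothesis.  (iii) No new
definitions, no new constants: every constant is one the route file already elaborates.

Disproof used: none exists — `ledger crux ls stmt-Langlands-18132` lists no workfiles (no `Disproof.lean`,
no `Negative/` lemma) at registration (2026-08-17); `ledger negatives --problem Langlands` = 4 entries
(SplitPrimeInduction ×2, OrdinaryPrimeTransport, K3KugaSatakeDescent), none of the stubs' shape.  Dead
lines: none recorded.  Refuter birth-attack (item note 2026-08-17T12:20Z): crux SURVIVES; `Langlands →
crux-minus-(π_∞ regular)` by pure logic (so `S ⇒ C` up to regularity — informational), `C ⇏ S`.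

BC3 probes (registrar's folder `bc/stub_irredParallel_probe{,2}.lean`,
`bc/stub_irredNonParallel_probe{,2}.lean`; each stub signature inlined VERBATIM as a sorry-free `def`;
all FAIL = pass): prescribed battery `set_option maxHeartbeats 400000 in example : Stub → T := by
first | exact? | simpa | aesop` for `T ∈ {EmbeddingNecklace.DeRhamLiftingIrred, _root_.Langlands}`:
4/4 FAIL (`unsolved goals … ⊢ DeRhamLiftingIrred` / `⊢ Langlands` after "aesop: failed to prove the
goal after exhaustive search"); unfolded variants `first | exact? | simpa [Stub] | (unfold Stub; simpa) |
aesop` and stub-and-target-unfolded: 4/4 FAIL (whnf heartbeat exhaustion at 4·10⁵); per tactic at 10⁶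
heartbeats, stub and target unfolded, stub introduced: `exact?` "could not close the goal" 4/4, `aesop`
heartbeat exhaustion 4/4; RESIDUAL-GOAL probe (hand the stub every hypothesis it shares with the crux
and attack the one remaining goal — the sector hypothesis `∀ v hv τ₁ τ₂, HT_{τ₁} = HT_{τ₂}`, resp.
`∃ v hv τ₁ τ₂, HT_{τ₁} ≠ HT_{τ₂}` — with `first | exact? | simp | aesop`): `unsolved goals` 2/2.  No
stub is cheaply the crux or the summit; the seam is not derivable from the crux's hypotheses.

Registration (2026-08-17): tree copy `Summits/Langlands/Langlands/Cruxes/DeRhamLiftingIrred/Lines/birth.lean`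
(first write commit c483e89f19bc; card `Lines/birth.md`); `ledger skeleton check <this file> --crux
stmt-Langlands-18132` → "OK — theorem …Birth.DeRhamLiftingIrred_of concludes
Summit.Langlands.Langlands.Theses.EmbeddingNecklace.DeRhamLiftingIrred; closed=True; stubs registered on
stmt-Langlands-18132: stub_irredParallel, stub_irredNonParallel" (`#h21_check_skeleton` ok=true, codes=[]).
Next, per the registry: each `propose --supports stmt-Langlands-18132` must prove a registered stub by
name + signature; when both land, the sorry-free skeleton is proposed `--workitem stmt-Langlands-18132`.
-/

set_option linter.dupNamespace false
set_option linter.unusedVariables false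

noncomputable section

namespace Summit.Langlands.Langlands.Cruxes.DeRhamLiftingIrred.Birth

open Summit.Langlands.Langlands.Theses.EmbeddingNecklace
open scoped NumberField
open NumberField IsDedekindDomain Field Filter
open Literature.NumberTheory.GaloisRepresentations Literature.NumberTheory.PAdicHodge
open Literature.NumberTheory.Automorphic

/-! ## 1. The registered stubs -/

/-- **STUB 1 — the PARALLEL-TYPE sector.**  The crux `DeRhamLiftingIrred` restricted to `ρ` whose
`τ`-labelled Hodge–Tate weights at each `v ∣ p` do not depend on the `ℚ_p`-embedding
`τ : F_v → ℚ̄_p` (`HT_{τ₁}(ρ|Γ_{F_v}) = HT_{τ₂}(ρ|Γ_{F_v})`, Fontaine's pinned datum): `F` totally real,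
`p ≥ 5` unramified in `F`, `ρ : Γ_F → GL₂(ℚ̄_p)` irreducible, unramified a.e., totally odd, de Rham with
two distinct labelled weights at every `(v, τ)`, PARALLEL at every `v ∣ p`, residually absolutely
irreducible at every `v ∣ p` and on `Γ_{F(ζ_p)}` (trace renderings), residually modular ⟹ `ρ` is
attached a.e. to a regular L-algebraic cuspidal `π` of `GL₂(𝔸_F)`.  In print: `f_v = 1` at all `v ∣ p`
(Kisin 2009 Thm (2.2.18) + Hu–Tan 2015 Thm 6.3: one embedding, parallel vacuously), `F_v ∈ {ℚ_p, ℚ_{p²}}`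
at all `v ∣ p` with generic Serre weights (Matsumoto 2025 Thm 1.2), `p` inert with `ρ̄|Γ_{F_p}`
semisimple BHHMS-generic, formally smooth local deformation rings on `S ∖ {p}` and regular parallel
weights (Jiang 2026 Thm 1.1.4; Rem 1.1.5).  Why it might fail to close soon: several `v ∣ p` of residue
degree `≥ 3`, the non-generic residual corner and `p = 5` are inside, and none of the three printed
engines is vendored in the tree.  Size XL (open problem in this generality).
[cite: Jiang2026, Thm 1.1.4 and Rem 1.1.5] [cite: Matsumoto2025, Thm 1.2] [cite: Kisin2009, Thm (2.2.18)]
[cite: HuTan2015, Thm 6.3] -/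
theorem stub_irredParallel :
    ∀ (F : Type) [Field F] [NumberField F], NumberField.IsTotallyReal F → ∀ (p : ℕ) [Fact p.Prime], 5 ≤ p → ¬ ((p : ℤ) ∣ NumberField.discr F) → ∀ (hcpt : Literature.NumberTheory.Automorphic.isCompact_glFiniteIntegralLevel 2 F) (ι : PadicAlgCl p ≃+* ℂ) (ρ : Literature.NumberTheory.GaloisRepresentations.FramedGaloisRep F (PadicAlgCl p) 2), ρ.toGaloisRep.IsIrreducible → (∀ᶠ v : IsDedekindDomain.HeightOneSpectrum (NumberField.RingOfIntegers F) in Filter.cofinite, ρ.IsUnramifiedAt v) → ρ.IsOdd → (∀ (v : IsDedekindDomain.HeightOneSpectrum (NumberField.RingOfIntegers F)) (hv : ((p : ℕ) : NumberField.RingOfIntegers F) ∈ v.asIdeal), (Literature.NumberTheory.PAdicHodge.fontainePstAdicCompletion v p hv).IsDeRhamFramed (ρ.toLocal v) ∧ ∀ τ : @AlgHom ℚ_[p] (v.adicCompletion F) (PadicAlgCl p) _ _ _ (Literature.NumberTheory.PAdicHodge.fontainePstAdicCompletion v p hv).algebra _, (ρ.labelledHodgeTateWeightsAt v (Literature.NumberTheory.PAdicHodge.fontainePstAdicCompletion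 v p hv).algebra (Literature.NumberTheory.PAdicHodge.fontainePstAdicCompletion v p hv).𝔅 (τ : v.adicCompletion F →+* PadicAlgCl p)).Nodup ∧ Multiset.card (ρ.labelledHodgeTateWeightsAt v (Literature.NumberTheory.PAdicHodge.fontainePstAdicCompletion v p hv).algebra (Literature.NumberTheory.PAdicHodge.fontainePstAdicCompletion v p hv).𝔅 (τ : v.adicCompletion F →+* PadicAlgCl p)) = 2) → (∀ (v : IsDedekindDomain.HeightOneSpectrum (NumberField.RingOfIntegers F)) (hv : ((p : ℕ) : NumberField.RingOfIntegers F) ∈ v.asIdeal), ∀ τ₁ τ₂ : @AlgHom ℚ_[p] (v.adicCompletion F) (PadicAlgCl p) _ _ _ (Literature.NumberTheory.PAdicHodge.fontainePstAdicCompletion v p hv).algebra _, ρ.labelledHodgeTateWeightsAt v (Literature.NumberTheory.PAdicHodge.fontainePstAdicCompletion v p hv).algebra (Literature.NumberTheory.PAdicHodge.fontainePstAdicCompletion v p hv).𝔅 (τ₁ : v.adicCompletion F →+* PadicAlgCl p) = ρ.labelledHodgeTateWeightsAt v (Literature.NumberTheory.PAdicHodge.fontainePstAdicCompletion v p hv).algebra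 (Literature.NumberTheory.PAdicHodge.fontainePstAdicCompletion v p hv).𝔅 (τ₂ : v.adicCompletion F →+* PadicAlgCl p)) → (∀ v : IsDedekindDomain.HeightOneSpectrum (NumberField.RingOfIntegers F), ((p : ℕ) : NumberField.RingOfIntegers F) ∈ v.asIdeal → ¬ ∃ χ₁ χ₂ : Field.absoluteGaloisGroup (v.adicCompletion F) →* (PadicAlgCl p)ˣ, IsOpen (χ₁.ker : Set (Field.absoluteGaloisGroup (v.adicCompletion F))) ∧ IsOpen (χ₂.ker : Set (Field.absoluteGaloisGroup (v.adicCompletion F))) ∧ ∀ σ, ‖(ρ.toLocal v σ).val.trace - ((χ₁ σ : PadicAlgCl p) + (χ₂ σ : PadicAlgCl p))‖ < 1) → (¬ ∃ χ₁ χ₂ : Field.absoluteGaloisGroup (CyclotomicField p F) →* (PadicAlgCl p)ˣ, IsOpen (χ₁.ker : Set (Field.absoluteGaloisGroup (CyclotomicField p F))) ∧ IsOpen (χ₂.ker : Set (Field.absoluteGaloisGroup (CyclotomicField p F))) ∧ ∀ σ, ‖(ρ.restrictField (CyclotomicField p F) σ).val.trace - ((χ₁ σ : PadicAlgCl p) +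 (χ₂ σ : PadicAlgCl p))‖ < 1) → (∃ (π₀ : Literature.NumberTheory.Automorphic.CuspidalAutomorphicRepData 2 F hcpt) (ρ₀ : Literature.NumberTheory.GaloisRepresentations.FramedGaloisRep F (PadicAlgCl p) 2), π₀.1.IsLAlgebraic ∧ (∃ T : Literature.NumberTheory.Automorphic.InfinityType F 2, π₀.1.HasInfinityType T ∧ T.IsRegular) ∧ Literature.NumberTheory.Automorphic.SatakeFrobCompatibleAE ι π₀.1 ρ₀ ∧ ∀ σ, ‖(ρ σ).val.trace - (ρ₀ σ).val.trace‖ < 1) → ∃ π : Literature.NumberTheory.Automorphic.CuspidalAutomorphicRepData 2 F hcpt, π.1.IsLAlgebraic ∧ (∃ T : Literature.NumberTheory.Automorphic.InfinityType F 2, π.1.HasInfinityType T ∧ T.IsRegular) ∧ Literature.NumberTheory.Automorphic.SatakeFrobCompatibleAE ι π.1 ρ := by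
  sorry

/-- **STUB 2 — the NON-PARALLEL sector (the necklace's own regime; load-bearing).**  The crux
`DeRhamLiftingIrred` restricted to `ρ` for which SOME `v ∣ p` carries two `ℚ_p`-embeddings
`τ₁, τ₂ : F_v → ℚ̄_p` with different labelled Hodge–Tate weights `HT_{τ₁}(ρ|Γ_{F_v}) ≠ HT_{τ₂}(ρ|Γ_{F_v})`
(Fontaine's pinned datum; this forces `[F_v : ℚ_p] ≥ 2`): same hypotheses and conclusion as the crux
otherwise.  In print only for `F_v ∈ {ℚ_p, ℚ_{p²}}` at EVERY `v ∣ p` with generic Serre weights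
(Matsumoto 2025 Thm 1.2, Rem 1.1 "we crucially use `[F_v : ℚ_p] ≤ 2`"); for `f_v ≥ 3` in non-parallel
weight nothing is in print (Matsumoto 2025 Rem 1.15 / Conj 1.13, Jiang 2026 Rem 1.1.3: the tensor
induction `⊗_τ ρ^τ` has `2^f` de Rham jumps and the cube-edge Fontaine operators are not defined by the
filtration).  The route's plan for it is the necklace: PartialAlgebraization (stmt-Langlands-18136 =
QiuSu2025 Conj 2.1.2 'if' with typed coefficients) + NecklaceTransport (18137) + NecklaceClosure
(18138) over BigRTEigenvector (18139, GeeNewton2020 + BHHMS) and LocallyAlgebraicClassical (18140,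
Emerton2006 §7).  Why it might fail: QiuSu2025 Conj 2.1.2 'if' is open; BHHMS genericity is needed for
eigenvector existence and the non-generic corner (18142) is inside the stub.  Size XL (open problem).
[cite: Matsumoto2025, Thm 1.2, Rem 1.15 and Conj 1.13] [cite: Jiang2026, Rem 1.1.3]
[cite: QiuSu2025, Conj 2.1.2 and Thm 2.1.3] [cite: GeeNewton2020, §5] [cite: Emerton2006, §7] -/
theorem stub_irredNonParallel :
    ∀ (F : Type) [Field F] [NumberField F], NumberField.IsTotallyReal F → ∀ (p : ℕ) [Fact p.Prime], 5 ≤ p → ¬ ((p : ℤ) ∣ NumberField.discr F) → ∀ (hcpt : Literature.NumberTheory.Automorphic.isCompact_glFiniteIntegralLevel 2 F) (ι : PadicAlgCl p ≃+* ℂ) (ρ : Literature.NumberTheory.GaloisRepresentations.FramedGaloisRep F (PadicAlgCl p) 2), ρ.toGaloisRep.IsIrreducible → (∀ᶠ v : IsDedekindDomain.HeightOneSpectrum (NumberField.RingOfIntegers F) in Filter.cofinite, ρ.IsUnramifiedAt v) → ρ.IsOdd → (∀ (v : IsDedekindDomain.HeightOneSpectrum (NumberField.RingOfIntegers F)) (hv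 : ((p : ℕ) : NumberField.RingOfIntegers F) ∈ v.asIdeal), (Literature.NumberTheory.PAdicHodge.fontainePstAdicCompletion v p hv).IsDeRhamFramed (ρ.toLocal v) ∧ ∀ τ : @AlgHom ℚ_[p] (v.adicCompletion F) (PadicAlgCl p) _ _ _ (Literature.NumberTheory.PAdicHodge.fontainePstAdicCompletion v p hv).algebra _, (ρ.labelledHodgeTateWeightsAt v (Literature.NumberTheory.PAdicHodge.fontainePstAdicCompletion v p hv).algebra (Literature.NumberTheory.PAdicHodge.fontainePstAdicCompletion v p hv).𝔅 (τ : v.adicCompletion F →+* PadicAlgCl p)).Nodup ∧ Multiset.card (ρ.labelledHodgeTateWeightsAt v (Literature.NumberTheory.PAdicHodge.fontainePstAdicCompletion v p hv).algebra (Literature.NumberTheory.PAdicHodge.fontainePstAdicCompletion v p hv).𝔅 (τ : v.adicCompletion F →+* PadicAlgCl p)) = 2) → (∃ (v : IsDedekindDomain.HeightOneSpectrum (NumberField.RingOfIntegers F)) (hv : ((p : ℕ) : NumberField.RingOfIntegers F) ∈ v.asIdeal), ∃ τ₁ τ₂ : @AlgHom ℚ_[p] (v.adicCompletion F) (PadicAlgCl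 p) _ _ _ (Literature.NumberTheory.PAdicHodge.fontainePstAdicCompletion v p hv).algebra _, ρ.labelledHodgeTateWeightsAt v (Literature.NumberTheory.PAdicHodge.fontainePstAdicCompletion v p hv).algebra (Literature.NumberTheory.PAdicHodge.fontainePstAdicCompletion v p hv).𝔅 (τ₁ : v.adicCompletion F →+* PadicAlgCl p) ≠ ρ.labelledHodgeTateWeightsAt v (Literature.NumberTheory.PAdicHodge.fontainePstAdicCompletion v p hv).algebra (Literature.NumberTheory.PAdicHodge.fontainePstAdicCompletion v p hv).𝔅 (τ₂ : v.adicCompletion F →+* PadicAlgCl p)) → (∀ v : IsDedekindDomain.HeightOneSpectrum (NumberField.RingOfIntegers F), ((p : ℕ) : NumberField.RingOfIntegers F) ∈ v.asIdeal → ¬ ∃ χ₁ χ₂ : Field.absoluteGaloisGroup (v.adicCompletion F) →* (PadicAlgCl p)ˣ, IsOpen (χ₁.ker : Set (Field.absoluteGaloisGroup (v.adicCompletion F))) ∧ IsOpen (χ₂.ker : Set (Field.absoluteGaloisGroup (v.adicCompletion F))) ∧ ∀ σ, ‖(ρ.toLocal v σ).val.trace - ((χ₁ σ : PadicAlgCl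 p) + (χ₂ σ : PadicAlgCl p))‖ < 1) → (¬ ∃ χ₁ χ₂ : Field.absoluteGaloisGroup (CyclotomicField p F) →* (PadicAlgCl p)ˣ, IsOpen (χ₁.ker : Set (Field.absoluteGaloisGroup (CyclotomicField p F))) ∧ IsOpen (χ₂.ker : Set (Field.absoluteGaloisGroup (CyclotomicField p F))) ∧ ∀ σ, ‖(ρ.restrictField (CyclotomicField p F) σ).val.trace - ((χ₁ σ : PadicAlgCl p) + (χ₂ σ : PadicAlgCl p))‖ < 1) → (∃ (π₀ : Literature.NumberTheory.Automorphic.CuspidalAutomorphicRepData 2 F hcpt) (ρ₀ : Literature.NumberTheory.GaloisRepresentations.FramedGaloisRep F (PadicAlgCl p) 2), π₀.1.IsLAlgebraic ∧ (∃ T : Literature.NumberTheory.Automorphic.InfinityType F 2, π₀.1.HasInfinityType T ∧ T.IsRegular) ∧ Literature.NumberTheory.Automorphic.SatakeFrobCompatibleAE ι π₀.1 ρ₀ ∧ ∀ σ, ‖(ρ σ).val.trace - (ρ₀ σ).val.trace‖ < 1) → ∃ π : Literature.NumberTheory.Automorphic.CuspidalAutomorphicRepData 2 F hcpt, π.1.IsLAlgebraic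 ∧ (∃ T : Literature.NumberTheory.Automorphic.InfinityType F 2, π.1.HasInfinityType T ∧ T.IsRegular) ∧ Literature.NumberTheory.Automorphic.SatakeFrobCompatibleAE ι π.1 ρ := by
  sorry

/-! ## 2. The stub statements as named propositions (the composition's hypotheses, by name) -/

namespace _Goal

/-- The statement of `stub_irredParallel`, as a named `Prop` (literally its type). [folklore] -/
def stub_irredParallel : Prop :=
  type_of% @Summit.Langlands.Langlands.Cruxes.DeRhamLiftingIrred.Birth.stub_irredParallel

/-- The statement of `stub_irredNonParallel`, as a named `Prop` (literally its type). [folklore] -/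
def stub_irredNonParallel : Prop :=
  type_of% @Summit.Langlands.Langlands.Cruxes.DeRhamLiftingIrred.Birth.stub_irredNonParallel

end _Goal

/-! ## 3. The composition (kernel-checked, no `sorry`): parallel ∨ non-parallel → crux -/

/-- **`DeRhamLiftingIrred` from the two sector stubs.**  Given the crux's data, either the labelled
Hodge–Tate type of `ρ` is parallel at every `v ∣ p` — STUB 1 applies verbatim — or (excluded middle,
`push Not`) some `v ∣ p` carries two `ℚ_p`-embeddings with different labelled weights — STUB 2 applies
verbatim.  The crux's `let`-bound `p`-adic Hodge clause is passed to the stubs' `let`-free rendering by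
definitional unfolding.  Conclusion: the route decl, by name. [folklore] -/
theorem DeRhamLiftingIrred_of (hPar : _Goal.stub_irredParallel)
    (hNonPar : _Goal.stub_irredNonParallel) :
    Summit.Langlands.Langlands.Theses.EmbeddingNecklace.DeRhamLiftingIrred := by
  unfold _Goal.stub_irredParallel at hPar
  unfold _Goal.stub_irredNonParallel at hNonPar
  intro F _ _ hTR p _ hp hdisc hcpt ι ρ hirr hunr hodd hdR hloc hcyc hmod
  by_cases hpar :
      ∀ (v : HeightOneSpectrum (𝓞 F)) (hv : ((p : ℕ) : 𝓞 F) ∈ v.asIdeal),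
        ∀ τ₁ τ₂ : @AlgHom ℚ_[p] (v.adicCompletion F) (PadicAlgCl p) _ _ _
            (fontainePstAdicCompletion v p hv).algebra _,
          ρ.labelledHodgeTateWeightsAt v (fontainePstAdicCompletion v p hv).algebra
              (fontainePstAdicCompletion v p hv).𝔅 (τ₁ : v.adicCompletion F →+* PadicAlgCl p) =
            ρ.labelledHodgeTateWeightsAt v (fontainePstAdicCompletion v p hv).algebra
              (fontainePstAdicCompletion v p hv).𝔅 (τ₂ : v.adicCompletion F →+* PadicAlgCl p)
  · -- parallel at every `v ∣ p`: STUB 1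
    exact hPar F hTR p hp hdisc hcpt ι ρ hirr hunr hodd hdR hpar hloc hcyc hmod
  · -- non-parallel at some `v ∣ p`: STUB 2
    push Not at hpar
    exact hNonPar F hTR p hp hdisc hcpt ι ρ hirr hunr hodd hdR hpar hloc hcyc hmod

/-- By-name sanity check (an `example`, not a declaration of the file): the registered stubs feed the
composition as they stand. -/
example : Summit.Langlands.Langlands.Theses.EmbeddingNecklace.DeRhamLiftingIrred :=
  DeRhamLiftingIrred_of stub_irredParallel stub_irredNonParallel

end Summit.Langlands.Langlands.Cruxes.DeRhamLiftingIrred.Birth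

end
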